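import Literature.Probability.Percolation.TrackExchangeTransport
import HarnessLib

/-!
# Track exchange in a strip: what one sweep does to the edges below it and to a top endpoint

Grimmett–Manolescu, *Bond percolation on isoradial graphs* (PTRF 159 (2014) 273–327 =
arXiv:1204.0505), §6.3 (vertical crossings), proof of Lemma 6.9: an open path from height `0`
to its top endpoint `z = v_{x,j}` meets the track exchange `Σ_j` of the two tracks around height
`j`; "The lower endpoint of `γ` is not affected by `Σ_j`. The upper endpoint is affected only if
it is at height `j`, in which case its height decreases by at most `1` (see Figure 6.5)" — the
inequalities (6.32)–(6.33) — and, for the probability (6.34) that the height does *not* decrease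
("By studying the three relevant star–triangle transformations contributing to `Σ_j` as
illustrated in Figure 6.6, we find as in Figure 5.2 that …"), the mechanism by which the new
vertex `N_x` at `(x, j)` stays joined to the path.

This file proves these facts **edge by edge and for every value of the randomness**, for the
sweep `ExchangeData.sweep` of `TrackExchangeSweep` (direction left to right; levels `j - 1`, `j`
exchanged; rows `B = j - 1`, middle `= j`, `T = j + 1`):

* `ExchangeData.mem_sweep_iff_of_offMid` — **the frame of the sweep**: a pair of labels off the
  middle row and in different columns is open after the sweep iff it was open before (the moves
  only touch the star edges at `⋆`, the triangle edges, and rename `(i₀+1, j) ↔ ⋆`). Hence an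
  open path all of whose vertices lie below the middle row is untouched (GM14 (6.33)).
* `ExchangeData.mem_sweep_keptTop` — **the automatic case of Fig. 6.5**: if the path reaches its
  top `z = (x, j)` from `B_{x-1} = (x-1, j-1)`, the edge `(x-1, j-1)–(x, j)` is open after the
  sweep (it now ends at the new vertex `N_x`, which carries the label `(x, j)`).
* `ExchangeData.goodTop_sweep` — **the favourable case of Fig. 6.6**: if the path reaches `z`
  from `B_{x+1} = (x+1, j-1)`, the edge `e₃ = (x-2, j)–(x-1, j-1)` of the face to the left of `z`
  is closed, and the uniform variable driving the triangle → star move at the triangle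
  `(B_{x-1}, z, T_{x-1})` selects the single star edge towards `z` (`ExchangeData.goodU`, an
  event of probability `odds(p_{z T_{x-1}}) · odds(p_{B_{x-1} z})`, `volume_goodU`; GM14's factor
  `p_{e₁}p_{e₄}/((1-p_{e₁})(1-p_{e₄}))` in (6.37)), then after the sweep `B_{x+1}` is joined to
  the label `(x, j)` by an open path of at most three edges through `(x+2, j)` and `T_{x+1}`:
  the height of the top does not decrease. (Only `e₃` of GM14's four closed edges
  `e₁, …, e₄` is needed: it alone keeps the travelling edge `B_{x-1}T_{x-1}` closed.)
* `ExchangeData.volume_goodU`, `ExchangeData.le_volume_goodU` — the probability of the favourable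
  outcome and its lower bound `(p_{π-ε}/p_ε)²`-type under the bounded-angles hypothesis.

## References

* G. R. Grimmett, I. Manolescu, PTRF 159 (2014) 273–327, arXiv:1204.0505, §6.3: Lemma 6.9,
  (6.32)–(6.34), (6.37), Figures 6.5–6.6; §5.2 Figure 5.2 (the kernels).
* G. R. Grimmett, I. Manolescu, Ann. Probab. 41 (2013), arXiv:1105.5535, §3.3 Lemma 3.7 and
  Figure 11 (the same mechanism on the square/triangular lattice).
-/

noncomputable section

namespace Literature.Probability.Percolation

open LatticeModels StarTriangle Real MeasureTheory

namespace TrackExchange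

namespace ExchangeData

variable {D : ExchangeData}

/-! ### Membership of a pair after one move -/

/-- Off the triangle and the star, the even-stage move changes nothing. [cite: GrimmettManolescuAOP2013, Prop 2.2] -/
theorem mem_sStep_iff_of_ne (i₀ : ℤ) {e : Sym2 SV} (hT : ∀ k, e ≠ triEdge (D.evenTri i₀) k)
    (hS : ∀ k, e ≠ starEdge (D.evenTri i₀) none k) (ω : Set (Sym2 SV)) (u : unitInterval) :
    e ∈ D.sStep i₀ ω u ↔ e ∈ ω := by
  unfold ExchangeData.sStep
  exact mem_sMove_iff hT hS

/-- A pair of labels is not a star edge at `⋆`. [folklore] -/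
theorem some_some_ne_starEdge (v : Fin 3 → SV) (a b : ℤ × ℤ) (k : Fin 3) :
    s((some a : SV), some b) ≠ starEdge v none k := by
  intro h
  have : (none : SV) ∈ s((some a : SV), some b) := by rw [h]; exact Sym2.mem_mk_left _ _
  simp at this

/-- **Off the middle label and the triangle, the even-stage move changes no pair of labels.**
[cite: GrimmettManolescuAOP2013, Prop 2.2] -/
theorem some_some_mem_sStep_iff (i₀ : ℤ) {a b : ℤ × ℤ}
    (hT : ∀ k, s((some a : SV), some b) ≠ triEdge (D.evenTri i₀) k) (ω : Set (Sym2 SV)) (u : unitInterval) :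
    s((some a : SV), some b) ∈ D.sStep i₀ ω u ↔ s((some a : SV), some b) ∈ ω :=
  mem_sStep_iff_of_ne i₀ hT (some_some_ne_starEdge _ a b) ω u

/-- The relabelling is an involution. [folklore] -/
@[simp] theorem swapMid_swapMid (i : ℤ) (z : SV) : D.swapMid i (D.swapMid i z) = z :=
  Equiv.swap_apply_self _ _ _

/-- Membership after the odd-stage move, through the relabelling. [folklore] -/
theorem mem_tStep_iff (i₀ : ℤ) (e : Sym2 SV) (ω : Set (Sym2 SV)) (u : unitInterval) :
    e ∈ D.tStep i₀ ω u ↔ Sym2.map (D.swapMid (i₀ + 1)) e ∈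
      tMove (D.oddStage i₀) (triEdge (D.oddTri i₀)) (starEdge (D.oddTri i₀) none) ω u := by
  unfold ExchangeData.tStep
  rw [Set.mem_image]
  constructor
  · rintro ⟨e', he', rfl⟩
    rwa [sym2Equiv_apply, sym2Map_swapMid_swapMid]
  · intro h
    exact ⟨_, h, by rw [sym2Equiv_apply, sym2Map_swapMid_swapMid]⟩

/-- **Off the relabelled vertex and the travelling edge, the odd-stage move changes no pair of
labels.** [cite: GrimmettManolescuAOP2013, Prop 2.2] -/
theorem some_some_mem_tStep_iff (i₀ : ℤ) {a b : ℤ × ℤ} (ha : a ≠ (i₀ + 1, D.j)) (hb : b ≠ (i₀ + 1, D.j))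
    (hX : s((some a : SV), some b) ≠ s(D.bot i₀, D.top i₀)) (ω : Set (Sym2 SV)) (u : unitInterval) :
    s((some a : SV), some b) ∈ D.tStep i₀ ω u ↔ s((some a : SV), some b) ∈ ω := by
  rw [mem_tStep_iff, Sym2.map_mk, swapMid_of_ne (by simp) (by simpa [ExchangeData.mid] using ha),
    swapMid_of_ne (by simp) (by simpa [ExchangeData.mid] using hb)]
  refine mem_tMove_iff (fun k => ?_) (some_some_ne_starEdge _ a b)
  fin_cases k
  · show s((some a : SV), some b) ≠ s(D.oddTri i₀ 1, D.oddTri i₀ 2)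
    simp only [oddTri_one, oddTri_two, ExchangeData.mid, ExchangeData.top]
    intro h
    rcases sym2_some_some_eq_iff.1 h with ⟨rfl, -⟩ | ⟨-, rfl⟩
    · exact ha rfl
    · exact hb rfl
  · show s((some a : SV), some b) ≠ s(D.oddTri i₀ 0, D.oddTri i₀ 2)
    simpa only [oddTri_zero, oddTri_two] using hX
  · show s((some a : SV), some b) ≠ s(D.oddTri i₀ 0, D.oddTri i₀ 1)
    simp only [oddTri_zero, oddTri_one, ExchangeData.mid, ExchangeData.bot]
    intro h
    rcases sym2_some_some_eq_iff.1 h with ⟨-, rfl⟩ | ⟨rfl, -⟩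
    · exact hb rfl
    · exact ha rfl

/-- **The triangle laid down by the even-stage move** is `S` of the star state: its edge
opposite the corner `k` is open iff the `k`-th bit of `sMap` is set (clean configuration: the
triangle was absent). [cite: GrimmettManolescuAOP2013, Prop 2.2] -/
theorem triEdge_mem_sStep_iff (hV : D.Valid) {i₀ : ℤ} (hpar : Even (i₀ + D.j)) (hi : -(D.M : ℤ) ≤ i₀)
    (hi' : i₀ < D.M) {ω : Set (Sym2 SV)} (hc : Clean (D.evenStage i₀) ω) (u : unitInterval) (k : Fin 3) :
    triEdge (D.evenTri i₀) k ∈ D.sStep i₀ ω u ↔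
      sMap (triParam (D.oddStage (i₀ + 1)) (triEdge (D.evenTri i₀)))
        (readLocal (starEdge (D.evenTri i₀) none) ω) u k = true := by
  have h := readLocal_sMove (p := D.oddStage (i₀ + 1)) (eS := starEdge (D.evenTri i₀) none)
    (triEdge_injective (evenTri_injective i₀)) (Clean.triEdge_not_mem_of_even hV hpar hi hi' hc) u
  have := congrFun h k
  simp only [readLocal] at this
  unfold ExchangeData.sStep
  rw [← this]
  simp

/-- **The star laid down by the odd-stage move** is `T` of the triangle state: after the
relabelling, the label `(i₀+1, j)` (now borne by the new vertex) is joined to the corner `k` of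
the triangle — `B_{i₀}`, `⋆` (the old `O_{i₀+1}`), `T_{i₀}` for `k = 0, 1, 2` — iff the `k`-th bit
of `tMap` is set (clean configuration: `⋆` was isolated). [cite: GrimmettManolescuAOP2013, Prop 2.2] -/
theorem swap_starEdge_mem_tStep_iff {i₀ : ℤ} {ω : Set (Sym2 SV)} (hc : Clean (D.oddStage i₀) ω)
    (u : unitInterval) (k : Fin 3) :
    s(D.mid (i₀ + 1), D.swapMid (i₀ + 1) (D.oddTri i₀ k)) ∈ D.tStep i₀ ω u ↔
      tMap (triParam (D.oddStage i₀) (triEdge (D.oddTri i₀)))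
        (readLocal (triEdge (D.oddTri i₀)) ω) u k = true := by
  have hnone : ∀ k, starEdge (D.oddTri i₀) none k ∉ ω := fun k h =>
    Clean.none_not_mem_of_odd hc _ h (Sym2.mem_mk_left _ _)
  have h := readLocal_tMove (p := D.oddStage i₀) (eT := triEdge (D.oddTri i₀))
    (starEdge_injective (oddTri_injective i₀) (oddTri_ne_none i₀)) hnone u
  have := congrFun h k
  simp only [readLocal] at this
  rw [mem_tStep_iff, Sym2.map_mk, swapMid_mid, swapMid_swapMid]
  change starEdge (D.oddTri i₀) none k ∈ _ ↔ _
  rw [← this]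
  simp

/-- Reading a triangle bit. [folklore] -/
theorem readLocal_triEdge_eq_true_iff (v : Fin 3 → SV) (ω : Set (Sym2 SV)) (k : Fin 3) :
    readLocal (triEdge v) ω k = true ↔ triEdge v k ∈ ω := by
  simp [readLocal]

/-- Reading a star bit. [folklore] -/
theorem readLocal_starEdge_eq_true_iff (v : Fin 3 → SV) (ω : Set (Sym2 SV)) (k : Fin 3) :
    readLocal (starEdge v none) ω k = true ↔ starEdge v none k ∈ ω := by
  simp [readLocal]

/-! ### The frame of the sweep: pairs off the middle row -/

/-- A pair of labels off the middle row and in different columns is not a triangle edge of an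
even-stage move. [folklore] -/
theorem some_some_ne_triEdge_evenTri (i₀ : ℤ) {a b : ℤ × ℤ} (ha : a.2 ≠ D.j) (hb : b.2 ≠ D.j)
    (hab : a.1 ≠ b.1) (k : Fin 3) : s((some a : SV), some b) ≠ triEdge (D.evenTri i₀) k := by
  fin_cases k
  · show s((some a : SV), some b) ≠ s(D.evenTri i₀ 1, D.evenTri i₀ 2)
    simp only [evenTri_one, evenTri_two, ExchangeData.bot, ExchangeData.top]
    intro h
    rcases sym2_some_some_eq_iff.1 h with ⟨rfl, rfl⟩ | ⟨rfl, rfl⟩ <;> exact hab rfl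
  · show s((some a : SV), some b) ≠ s(D.evenTri i₀ 0, D.evenTri i₀ 2)
    simp only [evenTri_zero, evenTri_two, ExchangeData.mid, ExchangeData.top]
    intro h
    rcases sym2_some_some_eq_iff.1 h with ⟨rfl, -⟩ | ⟨-, rfl⟩
    · exact ha rfl
    · exact hb rfl
  · show s((some a : SV), some b) ≠ s(D.evenTri i₀ 0, D.evenTri i₀ 1)
    simp only [evenTri_zero, evenTri_one, ExchangeData.mid, ExchangeData.bot]
    intro h
    rcases sym2_some_some_eq_iff.1 h with ⟨rfl, -⟩ | ⟨-, rfl⟩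
    · exact ha rfl
    · exact hb rfl

/-- **One move does not touch a pair off the middle row in different columns.**
[cite: GrimmettManolescu2014Isoradial, §5.3] -/
theorem some_some_mem_moveStep_iff (i₀ : ℤ) {a b : ℤ × ℤ} (ha : a.2 ≠ D.j) (hb : b.2 ≠ D.j)
    (hab : a.1 ≠ b.1) (ω : Set (Sym2 SV)) (u : unitInterval) :
    s((some a : SV), some b) ∈ D.moveStep i₀ ω u ↔ s((some a : SV), some b) ∈ ω := by
  unfold ExchangeData.moveStep
  split_ifs with hpar
  · exact some_some_mem_sStep_iff i₀ (some_some_ne_triEdge_evenTri i₀ ha hb hab) ω u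
  · refine some_some_mem_tStep_iff i₀ (fun h => ha (by rw [h])) (fun h => hb (by rw [h])) (fun h => ?_) ω u
    simp only [ExchangeData.bot, ExchangeData.top] at h
    rcases sym2_some_some_eq_iff.1 h with ⟨rfl, rfl⟩ | ⟨rfl, rfl⟩ <;> exact hab rfl

/-- Sliding does not touch a pair off the middle row in different columns. [cite: GrimmettManolescu2014Isoradial, §5.3] -/
theorem some_some_mem_slide_iff {a b : ℤ × ℤ} (ha : a.2 ≠ D.j) (hb : b.2 ≠ D.j) (hab : a.1 ≠ b.1)
    (ω : Set (Sym2 SV)) (u : Fin (2 * D.M) → unitInterval) :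
    s((some a : SV), some b) ∈ D.slide ω u ↔ s((some a : SV), some b) ∈ ω :=
  RandomMapChain.run_invariant (2 * D.M) D.sweepMoves ω u
    (fun _ ω' => s((some a : SV), some b) ∈ ω' ↔ s((some a : SV), some b) ∈ ω) Iff.rfl
    fun k ω' hk => (some_some_mem_moveStep_iff _ ha hb hab ω' (u k)).trans hk

/-- Insertion does not touch a pair off the middle row in different columns. [cite: GrimmettManolescu2014Isoradial, §5.3] -/
theorem some_some_mem_insertStep_iff {a b : ℤ × ℤ} (ha : a.2 ≠ D.j) (hb : b.2 ≠ D.j) (hab : a.1 ≠ b.1)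
    (ω : Set (Sym2 SV)) (u₀ : unitInterval) :
    s((some a : SV), some b) ∈ D.insertStep ω u₀ ↔ s((some a : SV), some b) ∈ ω := by
  classical
  unfold ExchangeData.insertStep
  split_ifs with hpar
  · rw [mem_resample_iff]
    have hne : s((some a : SV), some b) ≠ s(none, D.mid (-(D.M : ℤ))) := by simp [ExchangeData.mid]
    rw [or_iff_left (fun h' => hne h'.1), and_iff_right hne, Set.mem_image]
    have hfix : Sym2.map (D.swapMid (-(D.M : ℤ))) s((some a : SV), some b) = s((some a : SV), some b) := by
      rw [Sym2.map_mk, swapMid_of_ne (by simp) (by simp [ExchangeData.mid]; intro h; exact ha (by rw [h])),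
        swapMid_of_ne (by simp) (by simp [ExchangeData.mid]; intro h; exact hb (by rw [h]))]
    constructor
    · rintro ⟨e', he', h'⟩
      rw [sym2Equiv_apply] at h'
      have : e' = s((some a : SV), some b) := by
        rw [← sym2Map_swapMid_swapMid (D := D) (-(D.M : ℤ)) e', h', hfix]
      rwa [← this]
    · intro h
      exact ⟨_, h, by rw [sym2Equiv_apply, hfix]⟩
  · rw [mem_resample_iff]
    have hne : s((some a : SV), some b) ≠ s(D.bot (-(D.M : ℤ)), D.top (-(D.M : ℤ))) := by
      simp only [ExchangeData.bot, ExchangeData.top]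
      intro h
      rcases sym2_some_some_eq_iff.1 h with ⟨rfl, rfl⟩ | ⟨rfl, rfl⟩ <;> exact hab rfl
    simp [hne]

/-- Removal does not touch a pair in different columns. [cite: GrimmettManolescu2014Isoradial, §5.3] -/
theorem some_some_mem_removeStep_iff {a b : ℤ × ℤ} (hab : a.1 ≠ b.1) (ω : Set (Sym2 SV)) :
    s((some a : SV), some b) ∈ D.removeStep ω ↔ s((some a : SV), some b) ∈ ω := by
  unfold ExchangeData.removeStep
  split_ifs with hpar
  · simp
  · rw [Set.mem_sdiff, Set.mem_singleton_iff]
    have hne : s((some a : SV), some b) ≠ s(D.bot D.M, D.top D.M) := by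
      simp only [ExchangeData.bot, ExchangeData.top]
      intro h
      rcases sym2_some_some_eq_iff.1 h with ⟨rfl, rfl⟩ | ⟨rfl, rfl⟩ <;> exact hab rfl
    simp [hne]

/-- **The frame of the sweep** (GM14 (6.33): "the upper endpoint is affected only if it is at
height `j`"): a pair of labels off the middle row `j` and in different columns — in particular
every edge of the lattice both of whose endpoints lie below the middle row, or both above — is
open after `Σ_j` iff it was open before, for every value of the randomness.
[cite: GrimmettManolescu2014Isoradial, §6.3 (6.33)] -/
theorem mem_sweep_iff_of_offMid {a b : ℤ × ℤ} (ha : a.2 ≠ D.j) (hb : b.2 ≠ D.j) (hab : a.1 ≠ b.1)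
    (ω : Set (Sym2 SV)) (r : unitInterval × (Fin (2 * D.M) → unitInterval)) :
    s((some a : SV), some b) ∈ D.sweep ω r ↔ s((some a : SV), some b) ∈ ω := by
  unfold ExchangeData.sweep
  rw [some_some_mem_removeStep_iff hab, some_some_mem_slide_iff ha hb hab, some_some_mem_insertStep_iff ha hb hab]

/-! ### A stage-indexed invariant of the slide -/

/-- **Invariants along the slide, with the cleanliness bookkeeping**: a property of (stage,
configuration) that holds at stage `-M` for a clean configuration and is preserved by every move
(the move being applied to a configuration clean for its stage) holds at stage `M`.
[cite: GrimmettManolescu2014Isoradial, §5.3] -/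
theorem slide_invariant (hV : D.Valid) (P : ℤ → Set (Sym2 SV) → Prop) {ω : Set (Sym2 SV)}
    (hc : Clean (D.stage (-(D.M : ℤ))) ω) (h0 : P (-(D.M : ℤ)) ω) (u : Fin (2 * D.M) → unitInterval)
    (hstep : ∀ (t : Fin (2 * D.M)) (ω' : Set (Sym2 SV)), Clean (D.stage (-(D.M : ℤ) + t)) ω' →
      P (-(D.M : ℤ) + t) ω' → P (-(D.M : ℤ) + t + 1) (D.moveStep (-(D.M : ℤ) + t) ω' (u t))) :
    Clean (D.stage D.M) (D.slide ω u) ∧ P D.M (D.slide ω u) := by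
  have key := RandomMapChain.run_invariant (2 * D.M) D.sweepMoves ω u
    (fun n ω' => Clean (D.stage (-(D.M : ℤ) + n)) ω' ∧ P (-(D.M : ℤ) + n) ω') (by simpa using And.intro hc h0)
    fun k ω' hk => ?_
  · have h2 : (-(D.M : ℤ) + ((2 * D.M : ℕ) : ℤ)) = D.M := by push_cast; ring
    rw [h2] at key
    exact key
  · obtain ⟨hk1, hk2⟩ := hk
    have e1 : (-(D.M : ℤ) + ((k : ℕ) : ℤ) + 1) = -(D.M : ℤ) + (((k : ℕ) + 1 : ℕ) : ℤ) := by push_cast; ring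
    refine ⟨?_, ?_⟩
    · have := Clean.moveStep hV (i₀ := -(D.M : ℤ) + k) (by omega) (by have := k.2; omega) hk1 (u k)
      rw [e1] at this
      exact this
    · have := hstep k ω' hk1 hk2
      rw [e1] at this
      exact this

/-! ### The automatic case: the path reaches its top from the left -/

section KeptTop

variable {x : ℤ}

/-- The edge `B_{x-1} z` with `z = (x, j)`: after the sweep the same pair of labels is the edge
`B_{x-1} N_x`. [folklore] -/
def leftTopEdge (D : ExchangeData) (x : ℤ) : Sym2 SV := s(some (x - 1, D.j - 1), some (x, D.j))

/-- **The odd-stage move at the triangle `(B_{x-1}, z, T_{x-1})` keeps `B_{x-1}` joined to the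
label `(x, j)`** if the edge `B_{x-1} z` was open: the star laid down contains the edges at the
endpoints of an open triangle edge (compatibility of `T`), and the new centre then takes the
label `(x, j)`. [cite: GrimmettManolescu2014Isoradial, §6.3 Fig. 6.5] -/
theorem leftTopEdge_mem_tStep {ω : Set (Sym2 SV)} (hc : Clean (D.oddStage (x - 1)) ω)
    (h : D.leftTopEdge x ∈ ω) (u : unitInterval) : D.leftTopEdge x ∈ D.tStep (x - 1) ω u := by
  set v := D.oddTri (x - 1) with hv
  set t : Fin 3 → Bool := readLocal (triEdge v) ω with ht
  have ht2 : t 2 = true := by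
    rw [ht, readLocal_triEdge_eq_true_iff]
    show s(v 0, v 1) ∈ ω
    simp only [hv, oddTri_zero, oddTri_one, ExchangeData.bot, ExchangeData.mid, sub_add_cancel]
    exact h
  -- corners `0 = B_{x-1}` and `1 = z` are joined in the triangle, hence in the star
  have hcompat := compatible_tMap (triParam (D.oddStage (x - 1)) (triEdge v)) t u
  have htri : TriConn t 0 1 := Or.inr (Or.inl fun k hk0 hk1 => by
    have : k = 2 := by omega
    subst this; exact ht2)
  have hstar := (hcompat 0 1).1 htri
  have hs0 : tMap (triParam (D.oddStage (x - 1)) (triEdge v)) t u 0 = true := by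
    rcases hstar with h01 | ⟨h0, -⟩
    · exact absurd h01 (by decide)
    · exact h0
  have key := (swap_starEdge_mem_tStep_iff hc u 0).2 hs0
  rw [sub_add_cancel] at key
  have e0 : D.swapMid x (D.oddTri (x - 1) 0) = D.bot (x - 1) := by rw [oddTri_zero, swapMid_bot]
  rw [e0] at key
  unfold leftTopEdge
  rw [Sym2.eq_swap]
  exact key

/-- **The kept top, through the slide.** [cite: GrimmettManolescu2014Isoradial, §6.3 Fig. 6.5] -/
theorem leftTopEdge_mem_slide (hV : D.Valid)
    {ω : Set (Sym2 SV)} (hc : Clean (D.stage (-(D.M : ℤ))) ω) (h : D.leftTopEdge x ∈ ω)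
    (u : Fin (2 * D.M) → unitInterval) : D.leftTopEdge x ∈ D.slide ω u := by
  refine (slide_invariant hV (fun _ ω' => D.leftTopEdge x ∈ ω') hc h u fun t ω' hct hP => ?_).2
  set i₀ : ℤ := -(D.M : ℤ) + t with hi₀
  unfold ExchangeData.moveStep
  split_ifs with hpi
  · -- even stage: the pair is never a triangle edge of the move
    refine (some_some_mem_sStep_iff i₀ (fun k => ?_) ω' (u t)).2 hP
    fin_cases k
    · show s((some (x - 1, D.j - 1) : SV), some (x, D.j)) ≠ s(D.evenTri i₀ 1, D.evenTri i₀ 2)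
      simp only [evenTri_one, evenTri_two, ExchangeData.bot, ExchangeData.top]
      intro h'
      rcases sym2_some_some_eq_iff.1 h' with ⟨-, h2⟩ | ⟨h1, -⟩
      · have := (Prod.ext_iff.1 h2).2; simp only at this; omega
      · have := (Prod.ext_iff.1 h1).2; simp only at this; omega
    · show s((some (x - 1, D.j - 1) : SV), some (x, D.j)) ≠ s(D.evenTri i₀ 0, D.evenTri i₀ 2)
      simp only [evenTri_zero, evenTri_two, ExchangeData.mid, ExchangeData.top]
      intro h'
      rcases sym2_some_some_eq_iff.1 h' with ⟨h1, -⟩ | ⟨h1, -⟩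
      · have := (Prod.ext_iff.1 h1).2; simp only at this; omega
      · have := (Prod.ext_iff.1 h1).2; simp only at this; omega
    · show s((some (x - 1, D.j - 1) : SV), some (x, D.j)) ≠ s(D.evenTri i₀ 0, D.evenTri i₀ 1)
      simp only [evenTri_zero, evenTri_one, ExchangeData.mid, ExchangeData.bot]
      intro h'
      rcases sym2_some_some_eq_iff.1 h' with ⟨h1, -⟩ | ⟨h1, h2⟩
      · have := (Prod.ext_iff.1 h1).2; simp only at this; omega
      · -- `(x-1, j-1) = B_{i₀+1}` and `(x, j) = (i₀, j)` would force `x - 1 = x + 1`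
        have e1 := (Prod.ext_iff.1 h1).1
        have e2 := (Prod.ext_iff.1 h2).1
        simp only at e1 e2
        omega
  · -- odd stage
    by_cases hx : i₀ = x - 1
    · have hc' : Clean (D.oddStage (x - 1)) ω' := by
        have : D.stage i₀ = D.oddStage i₀ := by unfold ExchangeData.stage; rw [if_neg hpi]
        rw [← hx, ← this]; exact hct
      rw [hx]
      exact leftTopEdge_mem_tStep hc' hP (u t)
    · refine (some_some_mem_tStep_iff i₀ (fun h' => ?_) (fun h' => ?_) (fun h' => ?_) ω' (u t)).2 hP
      · have := (Prod.ext_iff.1 h').2; simp at this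
      · have := (Prod.ext_iff.1 h').1; simp only at this; exact hx (by omega)
      · simp only [ExchangeData.bot, ExchangeData.top] at h'
        rcases sym2_some_some_eq_iff.1 h' with ⟨h1, h2⟩ | ⟨h1, -⟩
        · have e1 := (Prod.ext_iff.1 h1).1
          have e2 := (Prod.ext_iff.1 h2).1
          simp only at e1 e2
          omega
        · have := (Prod.ext_iff.1 h1).2; simp only at this; omega

/-- **GM14 Fig. 6.5, the automatic case**: if the edge from `B_{x-1} = (x-1, j-1)` to the
middle-row vertex `z = (x, j)` is open before `Σ_j`, then the pair of labels `(x-1, j-1)–(x, j)`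
is open after `Σ_j` (it is now the edge `B_{x-1} N_x`), for every value of the randomness: a path
reaching its top `z` from the left keeps its height (clean configuration, `-M < x - 1`; for
`x + j` odd or `x - 1 ≥ M` the pair has weight zero and the statement is vacuous). [cite: GrimmettManolescu2014Isoradial, §6.3 (6.33), Fig. 6.5] -/
theorem mem_sweep_keptTop (hV : D.Valid) (hxl : -(D.M : ℤ) < x - 1)
    {ω : Set (Sym2 SV)} (hc : Clean D.initial ω) (h : s((some (x - 1, D.j - 1) : SV), some (x, D.j)) ∈ ω)
    (r : unitInterval × (Fin (2 * D.M) → unitInterval)) :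
    s((some (x - 1, D.j - 1) : SV), some (x, D.j)) ∈ D.sweep ω r := by
  unfold ExchangeData.sweep
  have hx1 : (x - 1 : ℤ) ≠ x := by omega
  rw [some_some_mem_removeStep_iff (a := (x - 1, D.j - 1)) (b := (x, D.j)) hx1]
  refine leftTopEdge_mem_slide hV (Clean.insertStep hV hc r.1) ?_ r.2
  -- insertion does not touch the pair (its middle label is not in column `-M`)
  classical
  unfold leftTopEdge ExchangeData.insertStep
  split_ifs with hpi
  · rw [mem_resample_iff]
    left
    refine ⟨sym2_some_some_ne_none_some _ _ _, ?_⟩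
    refine ⟨_, h, ?_⟩
    rw [sym2Equiv_apply, Sym2.map_mk, swapMid_of_ne (by simp) (by simp [ExchangeData.mid]),
      swapMid_of_ne (by simp) (by simp [ExchangeData.mid]; omega)]
  · rw [mem_resample_iff]
    left
    refine ⟨fun h' => ?_, h⟩
    simp only [ExchangeData.bot, ExchangeData.top] at h'
    rcases sym2_some_some_eq_iff.1 h' with ⟨h1, h2⟩ | ⟨h1, -⟩
    · have e1 := (Prod.ext_iff.1 h1).1; have e2 := (Prod.ext_iff.1 h2).1
      simp only at e1 e2; omega
    · have := (Prod.ext_iff.1 h1).2; simp only at this; omega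

end KeptTop

/-! ### The favourable case: the path reaches its top from the right -/

section GoodTop

variable {x : ℤ}

/-- Deciding that two pairs of labels differ, by their coordinates. [folklore] -/
theorem pair_ne {a₁ a₂ b₁ b₂ c₁ c₂ d₁ d₂ : ℤ}
    (h : ¬(((a₁ = c₁ ∧ a₂ = c₂) ∧ (b₁ = d₁ ∧ b₂ = d₂)) ∨ ((a₁ = d₁ ∧ a₂ = d₂) ∧ (b₁ = c₁ ∧ b₂ = c₂)))) :
    s((some (a₁, a₂) : SV), some (b₁, b₂)) ≠ s(some (c₁, c₂), some (d₁, d₂)) := by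
  intro h'
  rcases sym2_some_some_eq_iff.1 h' with ⟨h1, h2⟩ | ⟨h1, h2⟩ <;>
    simp only [Prod.mk.injEq] at h1 h2 <;> omega

/-- **One move does not touch a given pair of labels** unless it is a triangle edge of the move,
contains the relabelled vertex, or is the travelling edge — in coordinates, for `omega`.
[cite: GrimmettManolescu2014Isoradial, §5.3] -/
theorem some_some_mem_moveStep_iff' (i₀ : ℤ) {a₁ a₂ b₁ b₂ : ℤ}
    (h0 : ¬(((a₁ = i₀ + 1 ∧ a₂ = D.j - 1) ∧ (b₁ = i₀ + 1 ∧ b₂ = D.j + 1)) ∨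
      ((a₁ = i₀ + 1 ∧ a₂ = D.j + 1) ∧ (b₁ = i₀ + 1 ∧ b₂ = D.j - 1))))
    (h1 : ¬(((a₁ = i₀ ∧ a₂ = D.j) ∧ (b₁ = i₀ + 1 ∧ b₂ = D.j + 1)) ∨
      ((a₁ = i₀ + 1 ∧ a₂ = D.j + 1) ∧ (b₁ = i₀ ∧ b₂ = D.j))))
    (h2 : ¬(((a₁ = i₀ ∧ a₂ = D.j) ∧ (b₁ = i₀ + 1 ∧ b₂ = D.j - 1)) ∨
      ((a₁ = i₀ + 1 ∧ a₂ = D.j - 1) ∧ (b₁ = i₀ ∧ b₂ = D.j))))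
    (ha : ¬(a₁ = i₀ + 1 ∧ a₂ = D.j)) (hb : ¬(b₁ = i₀ + 1 ∧ b₂ = D.j))
    (hX : ¬(((a₁ = i₀ ∧ a₂ = D.j - 1) ∧ (b₁ = i₀ ∧ b₂ = D.j + 1)) ∨
      ((a₁ = i₀ ∧ a₂ = D.j + 1) ∧ (b₁ = i₀ ∧ b₂ = D.j - 1))))
    (ω : Set (Sym2 SV)) (u : unitInterval) :
    s((some (a₁, a₂) : SV), some (b₁, b₂)) ∈ D.moveStep i₀ ω u ↔ s((some (a₁, a₂) : SV), some (b₁, b₂)) ∈ ω := by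
  unfold ExchangeData.moveStep
  split_ifs with hpar
  · refine some_some_mem_sStep_iff i₀ (fun k => ?_) ω u
    fin_cases k
    · show s((some (a₁, a₂) : SV), some (b₁, b₂)) ≠ s(D.evenTri i₀ 1, D.evenTri i₀ 2)
      simp only [evenTri_one, evenTri_two, ExchangeData.bot, ExchangeData.top]
      exact pair_ne h0
    · show s((some (a₁, a₂) : SV), some (b₁, b₂)) ≠ s(D.evenTri i₀ 0, D.evenTri i₀ 2)
      simp only [evenTri_zero, evenTri_two, ExchangeData.mid, ExchangeData.top]
      exact pair_ne h1
    · show s((some (a₁, a₂) : SV), some (b₁, b₂)) ≠ s(D.evenTri i₀ 0, D.evenTri i₀ 1)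
      simp only [evenTri_zero, evenTri_one, ExchangeData.mid, ExchangeData.bot]
      exact pair_ne h2
  · refine some_some_mem_tStep_iff i₀ (fun h' => ha ?_) (fun h' => hb ?_) ?_ ω u
    · simpa [Prod.mk.injEq] using h'
    · simpa [Prod.mk.injEq] using h'
    · simp only [ExchangeData.bot, ExchangeData.top]
      exact pair_ne hX

/-- The edge `e₃ = (x-2, j)–(x-1, j-1)` of the face to the left of the top `z = (x, j)` (GM14's
`e₃ = ⟨v_{x-2,j}, v_{x-1,j-1}⟩`). [cite: GrimmettManolescu2014Isoradial, §6.3] -/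
def leftFaceEdge (D : ExchangeData) (x : ℤ) : Sym2 SV := s(some (x - 2, D.j), some (x - 1, D.j - 1))

/-- The last edge `B_{x+1} z` of a path reaching its top `z = (x, j)` from the right; after the
sweep the same pair of labels is the edge `B_{x+1} N_x`. [cite: GrimmettManolescu2014Isoradial, §6.3] -/
def rightTopEdge (D : ExchangeData) (x : ℤ) : Sym2 SV := s(some (x + 1, D.j - 1), some (x, D.j))

/-- **The favourable outcome** of the triangle → star move at the triangle `(B_{x-1}, z, T_{x-1})`
(stage `x - 1`): from the empty triangle, the uniform variable selects the single star edge
towards `z` (corner `1`). [cite: GrimmettManolescu2014Isoradial, §6.3 Fig. 6.6] -/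
def goodU (D : ExchangeData) (x : ℤ) : Set unitInterval :=
  {u | tMap (triParam (D.oddStage (x - 1)) (triEdge (D.oddTri (x - 1)))) ![false, false, false] u =
    ![false, true, false]}

/-- **The conclusion of the favourable case**: `B_{x+1} = (x+1, j-1)` is joined to the label
`(x, j)` directly, or through `(x+2, j)` and `T_{x+1} = (x+1, j+1)`. [cite: GrimmettManolescu2014Isoradial, §6.3] -/
def TopJoined (D : ExchangeData) (x : ℤ) (ω : Set (Sym2 SV)) : Prop :=
  D.rightTopEdge x ∈ ω ∨
    (s((some (x + 1, D.j - 1) : SV), some (x + 2, D.j)) ∈ ω ∧ s((some (x + 2, D.j) : SV), some (x + 1, D.j + 1)) ∈ ω ∧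
      s((some (x + 1, D.j + 1) : SV), some (x, D.j)) ∈ ω)

/-- `goodU` is measurable. [folklore] -/
theorem measurableSet_goodU (D : ExchangeData) (x : ℤ) : MeasurableSet (D.goodU x) :=
  (measurable_tMap _ _) (measurableSet_singleton _)

/-- The stage-indexed invariant of the favourable case (see `goodTop_slide`). [cite: GrimmettManolescu2014Isoradial, §6.3] -/
def GoodInv (D : ExchangeData) (x i₀ : ℤ) (ω : Set (Sym2 SV)) : Prop :=
  (i₀ ≤ x - 3 → D.leftFaceEdge x ∉ ω ∧ D.rightTopEdge x ∈ ω) ∧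
  (i₀ = x - 2 → s((none : SV), some (x - 1, D.j - 1)) ∉ ω ∧ D.rightTopEdge x ∈ ω) ∧
  (i₀ = x - 1 → s((some (x - 1, D.j - 1) : SV), some (x - 1, D.j + 1)) ∉ ω ∧ D.rightTopEdge x ∈ ω) ∧
  (i₀ = x → s((none : SV), some (x, D.j)) ∈ ω ∧ s((some (x + 1, D.j - 1) : SV), none) ∈ ω) ∧
  (i₀ = x + 1 → D.rightTopEdge x ∈ ω ∨
    (s((some (x + 1, D.j - 1) : SV), some (x + 1, D.j + 1)) ∈ ω ∧ s((some (x + 1, D.j + 1) : SV), some (x, D.j)) ∈ ω)) ∧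
  (x + 2 ≤ i₀ → D.TopJoined x ω)

/-- `leftFaceEdge` is untouched by the moves at stages `≠ x-2, x-3`. [folklore] -/
theorem leftFaceEdge_mem_moveStep_iff {i₀ : ℤ} (h1 : i₀ ≠ x - 2) (h2 : i₀ ≠ x - 3) (ω : Set (Sym2 SV))
    (u : unitInterval) : D.leftFaceEdge x ∈ D.moveStep i₀ ω u ↔ D.leftFaceEdge x ∈ ω :=
  some_some_mem_moveStep_iff' i₀ (by omega) (by omega) (by omega) (by omega) (by omega) (by omega) ω u

/-- `rightTopEdge` is untouched by the moves at stages `≠ x, x-1`. [folklore] -/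
theorem rightTopEdge_mem_moveStep_iff {i₀ : ℤ} (h1 : i₀ ≠ x) (h2 : i₀ ≠ x - 1) (ω : Set (Sym2 SV))
    (u : unitInterval) : D.rightTopEdge x ∈ D.moveStep i₀ ω u ↔ D.rightTopEdge x ∈ ω :=
  some_some_mem_moveStep_iff' i₀ (by omega) (by omega) (by omega) (by omega) (by omega) (by omega) ω u

/-- `TopJoined` is untouched by the moves at stages `≥ x + 2`. [folklore] -/
theorem topJoined_moveStep {i₀ : ℤ} (hi : x + 2 ≤ i₀) {ω : Set (Sym2 SV)} (h : D.TopJoined x ω)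
    (u : unitInterval) : D.TopJoined x (D.moveStep i₀ ω u) := by
  rcases h with h | ⟨h1, h2, h3⟩
  · exact Or.inl ((rightTopEdge_mem_moveStep_iff (by omega) (by omega) ω u).2 h)
  · right
    exact ⟨(some_some_mem_moveStep_iff' i₀ (by omega) (by omega) (by omega) (by omega) (by omega) (by omega) ω u).2 h1,
      (some_some_mem_moveStep_iff' i₀ (by omega) (by omega) (by omega) (by omega) (by omega) (by omega) ω u).2 h2,
      (some_some_mem_moveStep_iff' i₀ (by omega) (by omega) (by omega) (by omega) (by omega) (by omega) ω u).2 h3⟩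

/-- The parity of a stage relative to `x`. [folklore] -/
theorem even_iff_of_even (hpar : Even (x + D.j)) (i₀ : ℤ) : Even (i₀ + D.j) ↔ Even (i₀ - x) := by
  constructor
  · rintro ⟨r, hr⟩; obtain ⟨q, hq⟩ := hpar; exact ⟨r - q, by omega⟩
  · rintro ⟨r, hr⟩; obtain ⟨q, hq⟩ := hpar; exact ⟨r + q, by omega⟩

/-- **Stage `x - 3` (odd): `e₃` closed before means `⋆ B_{x-1}` closed at the star of `O_{x-2}`.**
[cite: GrimmettManolescu2014Isoradial, §6.3 Fig. 6.6] -/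
theorem none_bot_notMem_tStep {ω : Set (Sym2 SV)} (h : D.leftFaceEdge x ∉ ω) (u : unitInterval) :
    s((none : SV), some (x - 1, D.j - 1)) ∉ D.tStep (x - 3) ω u := by
  rw [mem_tStep_iff, Sym2.map_mk, show x - 3 + 1 = x - 2 by ring, swapMid_none,
    swapMid_of_ne (by simp) (by simp [ExchangeData.mid])]
  intro h'
  refine h ((mem_tMove_iff (i := D.leftFaceEdge x) (fun k => ?_) (some_some_ne_starEdge _ _ _)).1 h')
  fin_cases k
  · show D.leftFaceEdge x ≠ s(D.oddTri (x - 3) 1, D.oddTri (x - 3) 2)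
    simp only [oddTri_one, oddTri_two, ExchangeData.mid, ExchangeData.top, leftFaceEdge]
    exact pair_ne (by omega)
  · show D.leftFaceEdge x ≠ s(D.oddTri (x - 3) 0, D.oddTri (x - 3) 2)
    simp only [oddTri_zero, oddTri_two, ExchangeData.bot, ExchangeData.top, leftFaceEdge]
    exact pair_ne (by omega)
  · show D.leftFaceEdge x ≠ s(D.oddTri (x - 3) 0, D.oddTri (x - 3) 1)
    simp only [oddTri_zero, oddTri_one, ExchangeData.mid, ExchangeData.bot, leftFaceEdge]
    exact pair_ne (by omega)

/-- **Stage `x - 2` (even): with `⋆ B_{x-1}` closed, the star → triangle move at `⋆ = O_{x-2}`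
does not lay down the travelling edge `B_{x-1} T_{x-1}`** (the corners `B_{x-1}`, `T_{x-1}` are
not joined through the star, hence not through the triangle). [cite: GrimmettManolescu2014Isoradial, §6.3 Fig. 6.6] -/
theorem travelling_notMem_sStep (hV : D.Valid) (hpar : Even (x - 2 + D.j)) (hi : -(D.M : ℤ) ≤ x - 2)
    (hi' : x - 2 < D.M) {ω : Set (Sym2 SV)} (hc : Clean (D.evenStage (x - 2)) ω)
    (h : s((none : SV), some (x - 1, D.j - 1)) ∉ ω) (u : unitInterval) :
    s((some (x - 1, D.j - 1) : SV), some (x - 1, D.j + 1)) ∉ D.sStep (x - 2) ω u := by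
  have he : s((some (x - 1, D.j - 1) : SV), some (x - 1, D.j + 1)) = triEdge (D.evenTri (x - 2)) 0 := by
    show _ = s(D.evenTri (x - 2) 1, D.evenTri (x - 2) 2)
    simp only [evenTri_one, evenTri_two, ExchangeData.bot, ExchangeData.top]
    rw [show x - 2 + 1 = x - 1 by ring]
  rw [he, triEdge_mem_sStep_iff hV hpar hi hi' hc u 0]
  set sb := readLocal (starEdge (D.evenTri (x - 2)) none) ω with hsb
  set t' := sMap (triParam (D.oddStage (x - 2 + 1)) (triEdge (D.evenTri (x - 2)))) sb u with ht'
  have hs1 : sb 1 = false := by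
    rw [Bool.eq_false_iff]
    intro h1
    rw [hsb, readLocal_starEdge_eq_true_iff] at h1
    refine h ?_
    have : starEdge (D.evenTri (x - 2)) none 1 = s((none : SV), some (x - 1, D.j - 1)) := by
      simp only [starEdge, evenTri_one, ExchangeData.bot]
      rw [show x - 2 + 1 = x - 1 by ring]
    rwa [this] at h1
  have hcompat := compatible_sMap (triParam (D.oddStage (x - 2 + 1)) (triEdge (D.evenTri (x - 2)))) sb u
  intro h0
  have htri : TriConn t' 1 2 := Or.inr (Or.inl fun k hk1 hk2 => by
    have : k = 0 := by omega
    subst this; exact h0)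
  rcases (hcompat 1 2).1 htri with h12 | ⟨h1, -⟩
  · exact absurd h12 (by decide)
  · rw [hs1] at h1; exact absurd h1 (by decide)

/-- **Stage `x - 1` (odd), the heart of Fig. 6.6**: with the travelling edge `B_{x-1} T_{x-1}`
closed, the triangle `(B_{x-1}, z, T_{x-1})` is empty or has an open edge at `z`; in the second
case the star laid down joins the new centre to `z` surely, in the first case it does so when
the uniform variable falls in `goodU`. After the relabelling: `⋆` (the old `z`) is joined to the
label `(x, j)` (the new vertex). [cite: GrimmettManolescu2014Isoradial, §6.3 (6.37), Fig. 6.6] -/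
theorem none_mid_mem_tStep {ω : Set (Sym2 SV)} (hc : Clean (D.oddStage (x - 1)) ω)
    (hX : s((some (x - 1, D.j - 1) : SV), some (x - 1, D.j + 1)) ∉ ω) {u : unitInterval}
    (hu : readLocal (triEdge (D.oddTri (x - 1))) ω = ![false, false, false] → u ∈ D.goodU x) :
    s((none : SV), some (x, D.j)) ∈ D.tStep (x - 1) ω u := by
  set v := D.oddTri (x - 1) with hv
  set t : Fin 3 → Bool := readLocal (triEdge v) ω with ht
  have key := swap_starEdge_mem_tStep_iff hc u 1
  rw [sub_add_cancel] at key
  have e1 : D.swapMid x (D.oddTri (x - 1) 1) = none := by rw [oddTri_one, sub_add_cancel, swapMid_mid]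
  rw [e1] at key
  rw [Sym2.eq_swap, show (some (x, D.j) : SV) = D.mid x from rfl, key]
  -- the travelling edge (opposite the corner `1 = z`) is closed
  have ht1 : t 1 = false := by
    rw [Bool.eq_false_iff]; intro h1
    rw [ht, readLocal_triEdge_eq_true_iff] at h1
    refine hX ?_
    have : triEdge v 1 = s(v 0, v 2) := rfl
    rw [this, hv, oddTri_zero, oddTri_two] at h1
    simpa [ExchangeData.bot, ExchangeData.top] using h1
  have hcompat := compatible_tMap (triParam (D.oddStage (x - 1)) (triEdge v)) t u
  by_cases h2 : t 2 = true
  · -- the edge `B_{x-1} z` is open: corners `0, 1` joined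
    have htri : TriConn t 0 1 := Or.inr (Or.inl fun k hk0 hk1 => by
      have : k = 2 := by omega
      subst this; exact h2)
    rcases (hcompat 0 1).1 htri with h01 | ⟨-, h1⟩
    · exact absurd h01 (by decide)
    · exact h1
  by_cases h0 : t 0 = true
  · -- the edge `z T_{x-1}` is open: corners `1, 2` joined
    have htri : TriConn t 1 2 := Or.inr (Or.inl fun k hk1 hk2 => by
      have : k = 0 := by omega
      subst this; exact h0)
    rcases (hcompat 1 2).1 htri with h12 | ⟨h1, -⟩
    · exact absurd h12 (by decide)
    · exact h1
  · -- the triangle is empty: the favourable outcome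
    have hte : t = ![false, false, false] := by
      funext k
      fin_cases k
      · simpa using h0
      · exact ht1
      · simpa using h2
    have hu' := hu hte
    simp only [goodU, Set.mem_setOf_eq] at hu'
    show tMap (triParam (D.oddStage (x - 1)) (triEdge (D.oddTri (x - 1)))) t u 1 = true
    rw [hte, hu']
    rfl

/-- At stage `x - 1` the last edge `B_{x+1} z` becomes `B_{x+1} ⋆`. [folklore] -/
theorem bot_none_mem_tStep {ω : Set (Sym2 SV)} (h : D.rightTopEdge x ∈ ω) (u : unitInterval) :
    s((some (x + 1, D.j - 1) : SV), none) ∈ D.tStep (x - 1) ω u := by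
  rw [mem_tStep_iff, Sym2.map_mk, sub_add_cancel, swapMid_none, swapMid_of_ne (by simp) (by simp [ExchangeData.mid])]
  refine (mem_tMove_iff (i := s((some (x + 1, D.j - 1) : SV), D.mid x)) (fun k => ?_) ?_).2 h
  · fin_cases k
    · show s((some (x + 1, D.j - 1) : SV), D.mid x) ≠ s(D.oddTri (x - 1) 1, D.oddTri (x - 1) 2)
      simp only [oddTri_one, oddTri_two, ExchangeData.mid, ExchangeData.top]
      exact pair_ne (by omega)
    · show s((some (x + 1, D.j - 1) : SV), D.mid x) ≠ s(D.oddTri (x - 1) 0, D.oddTri (x - 1) 2)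
      simp only [oddTri_zero, oddTri_two, ExchangeData.mid, ExchangeData.bot, ExchangeData.top]
      exact pair_ne (by omega)
    · show s((some (x + 1, D.j - 1) : SV), D.mid x) ≠ s(D.oddTri (x - 1) 0, D.oddTri (x - 1) 1)
      simp only [oddTri_zero, oddTri_one, ExchangeData.mid, ExchangeData.bot]
      exact pair_ne (by omega)
  · intro k
    simp only [ExchangeData.mid]
    exact some_some_ne_starEdge _ _ _ k

/-- **Stage `x` (even): the star at `⋆` (the old `z`) has open edges towards the label `(x, j)`
and towards `B_{x+1}`, so the triangle laid down joins these two corners** — directly, or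
through `T_{x+1}`. [cite: GrimmettManolescu2014Isoradial, §6.3 Fig. 6.6] -/
theorem joined_sStep (hV : D.Valid) (hpar : Even (x + D.j)) (hi : -(D.M : ℤ) ≤ x) (hi' : x < D.M)
    {ω : Set (Sym2 SV)} (hc : Clean (D.evenStage x) ω)
    (h1 : s((none : SV), some (x, D.j)) ∈ ω) (h2 : s((some (x + 1, D.j - 1) : SV), none) ∈ ω) (u : unitInterval) :
    D.rightTopEdge x ∈ D.sStep x ω u ∨
      (s((some (x + 1, D.j - 1) : SV), some (x + 1, D.j + 1)) ∈ D.sStep x ω u ∧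
        s((some (x + 1, D.j + 1) : SV), some (x, D.j)) ∈ D.sStep x ω u) := by
  set v := D.evenTri x with hv
  set sb := readLocal (starEdge v none) ω with hsb
  set t' := sMap (triParam (D.oddStage (x + 1)) (triEdge v)) sb u with ht'
  have hs0 : sb 0 = true := by
    rw [hsb, readLocal_starEdge_eq_true_iff]
    simpa [starEdge, hv, ExchangeData.mid] using h1
  have hs1 : sb 1 = true := by
    rw [hsb, readLocal_starEdge_eq_true_iff]
    have : starEdge v none 1 = s((some (x + 1, D.j - 1) : SV), none) := by
      rw [Sym2.eq_swap]; simp [starEdge, hv, ExchangeData.bot]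
    rw [this]; exact h2
  have hcompat := compatible_sMap (triParam (D.oddStage (x + 1)) (triEdge v)) sb u
  have htri : TriConn t' 0 1 := (hcompat 0 1).2 (Or.inr ⟨hs0, hs1⟩)
  -- the three triangle edges, as pairs of labels
  have e2 : triEdge v 2 = D.rightTopEdge x := by
    show s(v 0, v 1) = _
    rw [hv, evenTri_zero, evenTri_one, Sym2.eq_swap]; rfl
  have e0 : triEdge v 0 = s((some (x + 1, D.j - 1) : SV), some (x + 1, D.j + 1)) := by
    show s(v 1, v 2) = _
    rw [hv, evenTri_one, evenTri_two]; rfl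
  have e1 : triEdge v 1 = s((some (x + 1, D.j + 1) : SV), some (x, D.j)) := by
    show s(v 0, v 2) = _
    rw [hv, evenTri_zero, evenTri_two, Sym2.eq_swap]; rfl
  rcases htri with h01 | hk | ⟨h0, h1'⟩
  · exact absurd h01 (by decide)
  · left
    rw [← e2, triEdge_mem_sStep_iff hV hpar hi hi' hc u 2]
    exact hk 2 (by decide) (by decide)
  · right
    rw [← e0, ← e1, triEdge_mem_sStep_iff hV hpar hi hi' hc u 0, triEdge_mem_sStep_iff hV hpar hi hi' hc u 1]
    exact ⟨h0, h1'⟩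

/-- **Stage `x + 1` (odd): an open travelling edge `B_{x+1} T_{x+1}` is subdivided through the new
vertex, which then takes the label `(x+2, j)`.** [cite: GrimmettManolescu2014Isoradial, §6.3] -/
theorem subdivided_tStep {ω : Set (Sym2 SV)} (hc : Clean (D.oddStage (x + 1)) ω)
    (h : s((some (x + 1, D.j - 1) : SV), some (x + 1, D.j + 1)) ∈ ω) (u : unitInterval) :
    s((some (x + 1, D.j - 1) : SV), some (x + 2, D.j)) ∈ D.tStep (x + 1) ω u ∧
      s((some (x + 2, D.j) : SV), some (x + 1, D.j + 1)) ∈ D.tStep (x + 1) ω u := by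
  set v := D.oddTri (x + 1) with hv
  set t : Fin 3 → Bool := readLocal (triEdge v) ω with ht
  have ht1 : t 1 = true := by
    rw [ht, readLocal_triEdge_eq_true_iff]
    have : triEdge v 1 = s(v 0, v 2) := rfl
    rw [this, hv, oddTri_zero, oddTri_two]
    simpa [ExchangeData.bot, ExchangeData.top] using h
  have hcompat := compatible_tMap (triParam (D.oddStage (x + 1)) (triEdge v)) t u
  have htri : TriConn t 0 2 := Or.inr (Or.inl fun k hk0 hk2 => by
    have : k = 1 := by omega
    subst this; exact ht1)
  rcases (hcompat 0 2).1 htri with h02 | ⟨h0, h2⟩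
  · exact absurd h02 (by decide)
  have k0 := (swap_starEdge_mem_tStep_iff hc u 0).2 h0
  have k2 := (swap_starEdge_mem_tStep_iff hc u 2).2 h2
  rw [show x + 1 + 1 = x + 2 by ring] at k0 k2
  rw [oddTri_zero, swapMid_bot] at k0
  rw [oddTri_two, swapMid_top] at k2
  refine ⟨?_, ?_⟩
  · rw [Sym2.eq_swap]; simpa [ExchangeData.mid, ExchangeData.bot, add_sub_cancel_right] using k0
  · simpa [ExchangeData.mid, ExchangeData.top] using k2

/-- **The favourable case, through the slide**: the invariant `GoodInv` is preserved by every
move, the move at stage `x - 1` being driven by a uniform variable in `goodU` (when the triangle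
there is empty). [cite: GrimmettManolescu2014Isoradial, §6.3 Fig. 6.6] -/
theorem goodInv_moveStep (hV : D.Valid) (hpar : Even (x + D.j)) {i₀ : ℤ} (hi : -(D.M : ℤ) ≤ i₀) (hi' : i₀ < D.M)
    {ω : Set (Sym2 SV)} (hc : Clean (D.stage i₀) ω) (h : D.GoodInv x i₀ ω) {u : unitInterval}
    (hu : i₀ = x - 1 → u ∈ D.goodU x) :
    D.GoodInv x (i₀ + 1) (D.moveStep i₀ ω u) := by
  obtain ⟨c1, c2, c3, c4, c5, c6⟩ := h
  have hstage : ∀ i, D.stage i = if Even (i + D.j) then D.evenStage i else D.oddStage i := fun _ => rfl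
  have hpx := even_iff_of_even hpar
  -- parity of the special stages
  have hodd3 : ¬ Even (x - 3 + D.j) := by rw [hpx]; simp; decide
  have hev2 : Even (x - 2 + D.j) := by rw [hpx]; simp
  have hodd1 : ¬ Even (x - 1 + D.j) := by rw [hpx]; simp
  have hev0 : Even (x + D.j) := hpar
  have hodd1' : ¬ Even (x + 1 + D.j) := by rw [hpx]; simp
  refine ⟨fun h1 => ?_, fun h2 => ?_, fun h3 => ?_, fun h4 => ?_, fun h5 => ?_, fun h6 => ?_⟩
  · -- still far to the left of `z`
    obtain ⟨hl, hr⟩ := c1 (by omega)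
    exact ⟨fun h' => hl ((leftFaceEdge_mem_moveStep_iff (by omega) (by omega) ω u).1 h'),
      (rightTopEdge_mem_moveStep_iff (by omega) (by omega) ω u).2 hr⟩
  · -- stage `x - 3 → x - 2`
    have hi₀ : i₀ = x - 3 := by omega
    subst hi₀
    obtain ⟨hl, hr⟩ := c1 le_rfl
    refine ⟨?_, (rightTopEdge_mem_moveStep_iff (by omega) (by omega) ω u).2 hr⟩
    unfold ExchangeData.moveStep
    rw [if_neg hodd3]
    exact none_bot_notMem_tStep hl u
  · -- stage `x - 2 → x - 1`
    have hi₀ : i₀ = x - 2 := by omega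
    subst hi₀
    obtain ⟨hl, hr⟩ := c2 rfl
    refine ⟨?_, (rightTopEdge_mem_moveStep_iff (by omega) (by omega) ω u).2 hr⟩
    unfold ExchangeData.moveStep
    rw [if_pos hev2]
    have hc' : Clean (D.evenStage (x - 2)) ω := by rw [hstage, if_pos hev2] at hc; exact hc
    exact travelling_notMem_sStep hV hev2 hi hi' hc' hl u
  · -- stage `x - 1 → x`
    have hi₀ : i₀ = x - 1 := by omega
    subst hi₀
    obtain ⟨hX, hr⟩ := c3 rfl
    have hc' : Clean (D.oddStage (x - 1)) ω := by rw [hstage, if_neg hodd1] at hc; exact hc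
    unfold ExchangeData.moveStep
    rw [if_neg hodd1]
    exact ⟨none_mid_mem_tStep hc' hX (fun _ => hu rfl), bot_none_mem_tStep hr u⟩
  · -- stage `x → x + 1`
    have hi₀ : i₀ = x := by omega
    subst hi₀
    obtain ⟨h1, h2⟩ := c4 rfl
    have hc' : Clean (D.evenStage i₀) ω := by rw [hstage, if_pos hev0] at hc; exact hc
    unfold ExchangeData.moveStep
    rw [if_pos hev0]
    exact joined_sStep hV hev0 hi hi' hc' h1 h2 u
  · -- stage `x + 1 → x + 2`, or later
    rcases lt_or_eq_of_le h6 with h6 | h6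
    · exact topJoined_moveStep (by omega) (c6 (by omega)) u
    · have hi₀ : i₀ = x + 1 := by omega
      subst hi₀
      have hc' : Clean (D.oddStage (x + 1)) ω := by rw [hstage, if_neg hodd1'] at hc; exact hc
      unfold ExchangeData.moveStep
      rw [if_neg hodd1']
      rcases c5 rfl with hr | ⟨hX, hT⟩
      · left
        have := (rightTopEdge_mem_moveStep_iff (D := D) (x := x) (i₀ := x + 1) (by omega) (by omega) ω u)
        unfold ExchangeData.moveStep at this
        rw [if_neg hodd1'] at this
        exact this.2 hr
      · right
        obtain ⟨k1, k2⟩ := subdivided_tStep hc' hX u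
        refine ⟨k1, k2, ?_⟩
        exact (some_some_mem_tStep_iff (x + 1) (by simp [Prod.mk.injEq]) (by simp [Prod.mk.injEq]; omega)
          (by simp only [ExchangeData.bot, ExchangeData.top]; exact pair_ne (by omega)) ω u).2 hT

/-- **The favourable case, pathwise** (GM14 §6.3, the event estimated in (6.37)): before the
slide (stage `-M`, after insertion) let `e₃` be closed and the last edge `B_{x+1} z` open, with
`-M ≤ x - 3` and `x + 2 ≤ M`; if the uniform variable of the move at stage `x - 1` lies in
`goodU` whenever the triangle there is empty, then after the slide `B_{x+1}` is joined to the
label `(x, j)` (`TopJoined`). [cite: GrimmettManolescu2014Isoradial, §6.3 (6.34), Fig. 6.6] -/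
theorem goodTop_slide (hV : D.Valid) (hpar : Even (x + D.j)) (hxl : -(D.M : ℤ) ≤ x - 3) (hxr : x + 2 ≤ D.M)
    {ω : Set (Sym2 SV)} (hc : Clean (D.stage (-(D.M : ℤ))) ω) (h3 : D.leftFaceEdge x ∉ ω)
    (hB : D.rightTopEdge x ∈ ω) (u : Fin (2 * D.M) → unitInterval)
    (hu : ∀ t : Fin (2 * D.M), -(D.M : ℤ) + t = x - 1 → u t ∈ D.goodU x) :
    D.TopJoined x (D.slide ω u) := by
  have h0 : D.GoodInv x (-(D.M : ℤ)) ω :=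
    ⟨fun _ => ⟨h3, hB⟩, fun h => by omega, fun h => by omega, fun h => by omega, fun h => by omega, fun h => by omega⟩
  have key := (slide_invariant hV (D.GoodInv x) hc h0 u fun t ω' hct hP =>
    goodInv_moveStep hV hpar (by omega) (by have := t.2; omega) hct hP (hu t)).2
  exact key.2.2.2.2.2 hxr

/-- **GM14 Fig. 6.6, the favourable case, for the whole sweep `Σ_j`**: if before the sweep the
edge `e₃ = (x-2, j)–(x-1, j-1)` is closed and the edge `B_{x+1} z`, `z = (x, j)`, is open
(clean configuration, `x + j` even, `-M ≤ x - 3`, `x + 2 ≤ M`), and the uniform variable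
driving the move at stage `x - 1` lies in `goodU`, then after the sweep `B_{x+1}` is joined to
the label `(x, j)` by one open edge, or by three through `(x+2, j)` and `T_{x+1}`: the top of
the path does not lose height. [cite: GrimmettManolescu2014Isoradial, §6.3 (6.34), (6.37), Fig. 6.6] -/
theorem goodTop_sweep (hV : D.Valid) (hpar : Even (x + D.j)) (hxl : -(D.M : ℤ) ≤ x - 3) (hxr : x + 2 ≤ D.M)
    {ω : Set (Sym2 SV)} (hc : Clean D.initial ω) (h3 : D.leftFaceEdge x ∉ ω) (hB : D.rightTopEdge x ∈ ω)
    (r : unitInterval × (Fin (2 * D.M) → unitInterval))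
    (hu : ∀ t : Fin (2 * D.M), -(D.M : ℤ) + t = x - 1 → r.2 t ∈ D.goodU x) :
    D.TopJoined x (D.sweep ω r) := by
  have hM : (0 : ℤ) < D.M := by omega
  -- insertion touches neither edge
  have h3' : D.leftFaceEdge x ∉ D.insertStep ω r.1 := fun h => h3 (by
    classical
    unfold ExchangeData.insertStep leftFaceEdge at h
    split_ifs at h with hpi
    · rw [mem_resample_iff] at h
      rcases h with ⟨-, h⟩ | ⟨h, -⟩
      · rw [Set.mem_image] at h
        obtain ⟨e', he', h'⟩ := h
        rw [sym2Equiv_apply] at h'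
        have : e' = D.leftFaceEdge x := by
          rw [← sym2Map_swapMid_swapMid (D := D) (-(D.M : ℤ)) e', h', Sym2.map_mk,
            swapMid_of_ne (by simp) (by simp [ExchangeData.mid]; omega), swapMid_of_ne (by simp) (by simp [ExchangeData.mid])]
          rfl
        rw [← this]; exact he'
      · exact absurd h (sym2_some_some_ne_none_some _ _ _)
    · rw [mem_resample_iff] at h
      rcases h with ⟨-, h⟩ | ⟨h, -⟩
      · exact h
      · simp only [ExchangeData.bot, ExchangeData.top] at h
        exact absurd h (pair_ne (by omega)))
  have hB' : D.rightTopEdge x ∈ D.insertStep ω r.1 := by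
    classical
    unfold ExchangeData.insertStep rightTopEdge
    split_ifs with hpi
    · rw [mem_resample_iff]
      left
      refine ⟨sym2_some_some_ne_none_some _ _ _, _, hB, ?_⟩
      rw [sym2Equiv_apply]
      show Sym2.map _ s(_, _) = _
      rw [Sym2.map_mk, swapMid_of_ne (by simp) (by simp [ExchangeData.mid]),
        swapMid_of_ne (by simp) (by simp [ExchangeData.mid]; omega)]
    · rw [mem_resample_iff]
      left
      refine ⟨?_, hB⟩
      simp only [ExchangeData.bot, ExchangeData.top]
      exact pair_ne (by omega)
  have key := goodTop_slide hV hpar hxl hxr (Clean.insertStep hV hc r.1) h3' hB' r.2 hu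
  -- removal touches none of the four edges
  unfold ExchangeData.sweep
  rcases key with k | ⟨k1, k2, k3⟩
  · left
    unfold rightTopEdge at k ⊢
    exact (some_some_mem_removeStep_iff (by simp) _).2 k
  · right
    exact ⟨(some_some_mem_removeStep_iff (by simp) _).2 k1, (some_some_mem_removeStep_iff (by simp) _).2 k2,
      (some_some_mem_removeStep_iff (by simp) _).2 k3⟩

/-! ### The probability of the favourable outcome -/

/-- The odds of `p_θ` are `sin(⅓(π-θ)) / sin(⅓θ)` (GM14 (2.3)). [cite: GrimmettManolescu2014Isoradial, §2.2 (2.3)] -/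
theorem odds_angleWeight {θ : ℝ} (hθ : θ ∈ Set.Ioo 0 π) :
    (angleWeight θ : ℝ) / (1 - angleWeight θ) = Real.sin ((π - θ) / 3) / Real.sin (θ / 3) := by
  have hA := sin_third_sub_pos hθ
  have hB := sin_third_pos hθ
  rw [coe_angleWeight ⟨hθ.1.le, hθ.2.le⟩]
  have hAB : Real.sin ((π - θ) / 3) + Real.sin (θ / 3) ≠ 0 := by linarith
  have h1 : 1 - Real.sin ((π - θ) / 3) / (Real.sin ((π - θ) / 3) + Real.sin (θ / 3)) =
      Real.sin (θ / 3) / (Real.sin ((π - θ) / 3) + Real.sin (θ / 3)) := by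
    field_simp; ring
  rw [h1, div_div_div_cancel_right₀ hAB]

/-- **A lower bound for the odds of `p_θ`**: `sin(⅓ε) ≤ p_θ/(1-p_θ)` for `0 < θ ≤ π - ε`. [folklore] -/
theorem sin_third_le_odds_angleWeight {ε θ : ℝ} (hε : 0 < ε) (hθ : 0 < θ) (hθε : θ ≤ π - ε) :
    Real.sin (ε / 3) ≤ (angleWeight θ : ℝ) / (1 - angleWeight θ) := by
  have hθ' : θ ∈ Set.Ioo 0 π := ⟨hθ, by linarith⟩
  rw [odds_angleWeight hθ']
  have hA := sin_third_sub_pos hθ'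
  have hB := sin_third_pos hθ'
  have hB1 : Real.sin (θ / 3) ≤ 1 := Real.sin_le_one _
  calc Real.sin (ε / 3) ≤ Real.sin ((π - θ) / 3) :=
        Real.sin_le_sin_of_le_of_le_pi_div_two (by linarith) (by linarith [hθ]) (by linarith)
    _ ≤ Real.sin ((π - θ) / 3) / Real.sin (θ / 3) := by
        rw [le_div_iff₀ hB]; nlinarith

/-- **A lower bound for `1 - p_θ = p_{π-θ}`**: `½ sin(⅓ε) ≤ 1 - p_θ` for `ε ≤ θ < π`. [folklore] -/
theorem half_sin_third_le_one_sub_angleWeight {ε θ : ℝ} (hε : 0 < ε) (hεθ : ε ≤ θ) (hθ : θ < π) :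
    Real.sin (ε / 3) / 2 ≤ 1 - (angleWeight θ : ℝ) := by
  have hθ' : θ ∈ Set.Ioo 0 π := ⟨by linarith, hθ⟩
  have hA := sin_third_sub_pos hθ'
  have hB := sin_third_pos hθ'
  have h1 : (1 : ℝ) - angleWeight θ = Real.sin (θ / 3) / (Real.sin ((π - θ) / 3) + Real.sin (θ / 3)) := by
    rw [coe_angleWeight ⟨hθ'.1.le, hθ'.2.le⟩]
    field_simp
    ring
  rw [h1, div_le_div_iff₀ (by norm_num) (by linarith)]
  have hA1 : Real.sin ((π - θ) / 3) ≤ 1 := Real.sin_le_one _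
  have hB1 : Real.sin (θ / 3) ≤ 1 := Real.sin_le_one _
  have hs : Real.sin (ε / 3) ≤ Real.sin (θ / 3) :=
    Real.sin_le_sin_of_le_of_le_pi_div_two (by linarith) (by linarith) (by linarith)
  have hs0 : 0 ≤ Real.sin (ε / 3) := by linarith [Real.sin_pos_of_pos_of_lt_pi (by linarith : 0 < ε / 3) (by linarith : ε / 3 < π)]
  nlinarith

/-- **The probability of the favourable outcome** (GM14 (6.37), first factor): the empty
triangle `(B_{x-1}, z, T_{x-1})` is sent to the single star edge towards `z` with probability
`odds(p_{z T_{x-1}}) · odds(p_{B_{x-1} z})` = `p_{e₁}p_{e₄}/((1-p_{e₁})(1-p_{e₄}))`, the two weights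
being `p_{β_j - α_{x-1}}` and `p_{π-(β_{j-1}-α_{x-1})}`. [cite: GrimmettManolescu2014Isoradial, §6.3 (6.37)] -/
theorem volume_goodU (hV : D.Valid) (hpar : ¬ Even (x - 1 + D.j)) (hi : -(D.M : ℤ) ≤ x - 1) (hi' : x - 1 < D.M) :
    volume (D.goodU x) = ENNReal.ofReal
      ((angleWeight (D.up - D.α (x - 1)) : ℝ) / (1 - angleWeight (D.up - D.α (x - 1))) *
        ((angleWeight (π - (D.lo - D.α (x - 1))) : ℝ) / (1 - angleWeight (π - (D.lo - D.α (x - 1)))))) := by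
  have hlu := hV.lu
  have hlo := hV.lo (x - 1) hi hi'
  have hup := hV.up (x - 1) hi hi'
  have hp : ∀ k, triParam (D.oddStage (x - 1)) (triEdge (D.oddTri (x - 1))) k ∈ Set.Ico (0 : ℝ) 1 := fun k =>
    ⟨(oddStage_triEdge_pos hV hi hi' hpar k).le, oddStage_triEdge_lt_one hpar hi hi' hlu hlo hup k⟩
  have hκ := kappa_oddStage_oddTri hpar hi hi' hlu hlo hup
  unfold goodU
  rw [volume_tMap_eq hp hκ]
  congr 1
  have h0 : triParam (D.oddStage (x - 1)) (triEdge (D.oddTri (x - 1))) 0 = angleWeight (D.up - D.α (x - 1)) :=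
    congrArg Subtype.val (oddStage_triEdge_zero hpar hi hi')
  have h2 : triParam (D.oddStage (x - 1)) (triEdge (D.oddTri (x - 1))) 2 = angleWeight (π - (D.lo - D.α (x - 1))) :=
    congrArg Subtype.val (oddStage_triEdge_two hpar hi hi')
  simp only [kernelWeight, odds, Matrix.cons_val_zero, Matrix.cons_val_one, Matrix.cons_val_two, Matrix.head_cons,
    Matrix.tail_cons, h0, h2]

/-- **The favourable outcome has probability at least `sin²(⅓ε)`** under the bounded-angles
hypothesis `β_j - α_{x-1}, β_{j-1} - α_{x-1} ∈ [ε, π - ε]` (GM14 (6.37): `≥ p_{π-ε}⁴ = 2δ` for the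
four-edge version). [cite: GrimmettManolescu2014Isoradial, §6.3 (6.37)] -/
theorem le_volume_goodU (hV : D.Valid) (hpar : ¬ Even (x - 1 + D.j)) (hi : -(D.M : ℤ) ≤ x - 1) (hi' : x - 1 < D.M)
    {ε : ℝ} (hε : 0 < ε) (hup : D.up - D.α (x - 1) ∈ Set.Icc ε (π - ε)) (hlo : D.lo - D.α (x - 1) ∈ Set.Icc ε (π - ε)) :
    ENNReal.ofReal (Real.sin (ε / 3) ^ 2) ≤ volume (D.goodU x) := by
  rw [volume_goodU hV hpar hi hi']
  refine ENNReal.ofReal_le_ofReal ?_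
  have hs0 : 0 ≤ Real.sin (ε / 3) := by
    have : ε ≤ π - ε := hup.1.trans hup.2
    exact (Real.sin_pos_of_pos_of_lt_pi (by linarith) (by linarith)).le
  have h1 := sin_third_le_odds_angleWeight hε (by linarith [hup.1]) hup.2
  have h2 := sin_third_le_odds_angleWeight (θ := π - (D.lo - D.α (x - 1))) hε (by linarith [hlo.2]) (by linarith [hlo.1])
  rw [sq]
  exact mul_le_mul h1 h2 hs0 (hs0.trans h1)

end GoodTop

end ExchangeData

end TrackExchange

end Literature.Probability.Percolation
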